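import Summits.CriticalPhenomena.SAWScalingLimit.Theorems.SAWReversalUpgradePathUpgradeRSLEHullPackage
import Literature.Probability.RandomPlanarGeometry.SLETraceKappaLimit
import Literature.Probability.RandomPlanarGeometry.BoundaryCorrespondence
import Literature.Probability.RandomPlanarGeometry.ConformalRestrictionProofs
import Literature.Probability.RandomPlanarGeometry.DrivingFunctionMeasurable
import Literature.Probability.RandomPlanarGeometry.LocalMartingaleProofs
import HarnessLib

/-!
# `stub_sleNoReturn` — the SLE_{8/3} reference sample does not return to `a` (crux
`PathUpgradeR`, stmt-CriticalPhenomena-18055, route `SAWReversalUpgrade`, line `bidir_windows`)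

Landing target:
`Summits/CriticalPhenomena/SAWScalingLimit/Theorems/SAWReversalUpgradePathUpgradeRSLENoReturn.lean`
(`--supports stmt-CriticalPhenomena-18055`; registered stub `stub_sleNoReturn` of
`Cruxes/PathUpgradeR/Lines/bidir_windows.lean`, statement verbatim).

**Theorem.** Let `(E; a, b)` be a Dobrushin domain with chordal uniformizing map `ψ : ℍ → E`
(boundary extension `ψ̄`, `ψ̄ 0 = a`), let `γ` be the SLE_{8/3} trace and `r u = ψ̄ (γ u)`. For
every `ρ₁ > 0` and every budget `β > 0` there is a deterministic `ρ₂ > 0` with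
`P' {∃ u' ≤ u, ρ₁ < |r u' - a| ∧ |r u - a| < ρ₂} ≤ β`.

**Proof.** (1) Deterministic core (`exists_pos_forall_le_dist`): if `r` is continuous, `r 0 = a`,
`r u ≠ a` for `u ≠ 0`, `a ≠ b` and `r t → b`, then for some `ρ₂ > 0` every `u ≥ u'` with
`ρ₁ < |r u' - a|` has `ρ₂ ≤ |r u - a|`: by continuity at `0` such `u'` are `≥ δ > 0`; on the
compact `[δ, max δ T₀]` the continuous positive `u ↦ |r u - a|` has a positive minimum, and past the
transience time `T₀` (`|r t - b| ≤ |a - b| / 2`) one has `|r u - a| ≥ |a - b| / 2`.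
(2) Almost surely the hypotheses of (1) hold: the trace is simple (`κ = 8/3 ≤ 4`, Rohde–Schramm
Thm. 6.1, `ae_isSimpleTrace_sleTrace_of_le_four_apply`), so `γ u ≠ 0` for `u > 0` and
`ψ̄ (γ u) ≠ a` (`MarkedDomain.boundaryExtension_ne_pt_zero`); transience (Rohde–Schramm Thm. 7.1,
`tendsto_norm_sleTrace_atTop_of_ne_eight`) composed with `ψ̄ z → b` at `∞`
(`MarkedDomain.IsChordalUniformizing.tendsto_boundaryExtension_cocompact`).
(3) Measurability and the limit: the bad event at level `1/(n+1)` is contained (strict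
inequalities, continuity in time) in the measurable event `B n` obtained by restricting the times
to a countable dense set; `B` is antitone with null intersection by (1)–(2), so
`P' (B n) → 0` (`tendsto_measure_iInter_atTop`). [folklore]
-/

noncomputable section

open scoped ENNReal NNReal Topology
open MeasureTheory Filter Set Metric TopologicalSpace
open Literature.Probability Literature.Probability.RandomPlanarGeometry
open UpperHalfPlane (upperHalfPlaneSet)

namespace Summit.CriticalPhenomena.SAWScalingLimit.Theorems

namespace PathUpgradeRSLERegNoReturn

/-- **Deterministic core.** If `r : [0, ∞) → ℂ` is continuous with `r 0 = a`, `r u ≠ a` for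
`u ≠ 0`, `a ≠ b` and `r t → b` (in the form: for every `ε > 0` eventually `|r t - b| ≤ ε`), then
for every `ρ₁ > 0` there is `ρ₂ > 0` such that `ρ₂ ≤ |r u - a|` whenever `u ≥ u'` and
`ρ₁ < |r u' - a|`. [folklore] -/
theorem exists_pos_forall_le_dist {r : ℝ≥0 → ℂ} {a b : ℂ} (hr : Continuous r) (h0 : r 0 = a)
    (hne : ∀ u : ℝ≥0, u ≠ 0 → r u ≠ a) (hab : a ≠ b)
    (htail : ∀ ε : ℝ, 0 < ε → ∃ T₀ : ℝ≥0, ∀ t : ℝ≥0, T₀ ≤ t → dist (r t) b ≤ ε)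
    {ρ₁ : ℝ} (hρ₁ : 0 < ρ₁) :
    ∃ ρ₂ : ℝ, 0 < ρ₂ ∧ ∀ u' u : ℝ≥0, u' ≤ u → ρ₁ < dist (r u') a → ρ₂ ≤ dist (r u) a := by
  -- times with `ρ₁ < |r u' - a|` are bounded below by some `δ > 0`
  obtain ⟨δ, hδ, hδr⟩ := Metric.continuous_iff.1 hr 0 ρ₁ hρ₁
  have hd : 0 < dist a b / 2 := half_pos (dist_pos.2 hab)
  obtain ⟨T₀, hT₀⟩ := htail (dist a b / 2) hd
  set δ₀ : ℝ≥0 := ⟨δ, hδ.le⟩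
  have hδ₀pos : (0 : ℝ≥0) < δ₀ := by
    rw [← NNReal.coe_lt_coe]
    exact hδ
  -- a positive lower bound on the compact `[δ₀, max δ₀ T₀]`
  have hK : IsCompact (Icc δ₀ (max δ₀ T₀)) := isCompact_Icc
  obtain ⟨m, hm, hmin⟩ := hK.exists_forall_le' (f := fun u ↦ dist (r u) a)
    (hr.dist continuous_const).continuousOn
    fun u hu ↦ dist_pos.2 (hne u (hδ₀pos.trans_le hu.1).ne')
  refine ⟨min m (dist a b / 2), lt_min hm hd, fun u' u hu'u hρ ↦ ?_⟩
  have hu' : δ₀ ≤ u' := by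
    by_contra hlt
    push Not at hlt
    have hdist : dist u' 0 < δ := by
      rw [NNReal.dist_eq, NNReal.coe_zero, sub_zero, NNReal.abs_eq]
      exact_mod_cast hlt
    have h := hδr u' hdist
    rw [h0] at h
    exact absurd hρ (not_lt.2 h.le)
  rcases le_or_gt u (max δ₀ T₀) with h | h
  · exact (min_le_left _ _).trans (hmin u ⟨hu'.trans hu'u, h⟩)
  · refine (min_le_right _ _).trans ?_
    have h1 := hT₀ u ((le_max_right _ _).trans h.le)
    have h2 := dist_triangle_left a b (r u)
    linarith

end PathUpgradeRSLERegNoReturn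

open PathUpgradeRSLERegNoReturn PathUpgradeRSLEHullPackage in
/-- **No return of the SLE_{8/3} reference to `a`** (registered stub `stub_sleNoReturn`, statement
verbatim): for every Dobrushin domain `E` with chordal uniformizing map `ψ`, every `ρ₁ > 0` and
every budget `β > 0` there is `ρ₂ > 0` such that the event "the image `ψ̄ ∘ γ` of the SLE_{8/3}
trace leaves the `ρ₁`-ball around `a = E.pt 0` and later comes back within `ρ₂` of `a`" has
`preWienerMeasure` at most `β`. Rohde–Schramm (2005) Thms. 6.1, 7.1 and Carathéodory's boundary
correspondence. [folklore] -/
theorem stub_sleNoReturn : ∀ (E : Literature.Probability.RandomPlanarGeometry.DobrushinDomain) (ψ : Literature.Probability.RandomPlanarGeometry.ConformalEquiv UpperHalfPlane.upperHalfPlaneSet E.carrier), E.IsChordalUniformizing ψ → ∀ ρ₁ : ℝ, 0 < ρ₁ → ∀ β : ENNReal, 0 < β → ∃ ρ₂ : ℝ, 0 < ρ₂ ∧ Literature.Probability.Process.preWienerMeasure {ω | ∃ u' u : NNReal, u' ≤ u ∧ ρ₁ < dist (ψ.boundaryExtension (Literature.Probability.RandomPlanarGeometry.sleTrace ((8:NNReal)/3)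 ω u')) (E.pt 0) ∧ dist (ψ.boundaryExtension (Literature.Probability.RandomPlanarGeometry.sleTrace ((8:NNReal)/3) ω u)) (E.pt 0) < ρ₂} ≤ β := by
  intro E ψ hψ ρ₁ hρ₁ β hβ
  haveI : IsProbabilityMeasure Process.preWienerMeasure := isProbabilityMeasure_preWienerMeasure'
  have hκ0 : (0 : ℝ≥0) < 8 / 3 := by positivity
  have hκ4 : (8 : ℝ≥0) / 3 ≤ 4 := by
    rw [div_le_iff₀ (by norm_num : (0 : ℝ≥0) < 3)]
    norm_num
  -- the image curve `u ↦ ψ̄ (γ u)`: continuity in time, measurability at fixed times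
  have hΦc : Continuous fun z ↦ ψ.boundaryExtension (Loewner.liftIm 0 z) :=
    continuous_boundaryExtension_liftIm ψ
  have hlift : ∀ (ω : ℝ≥0 → ℝ) (t : ℝ≥0),
      ψ.boundaryExtension (Loewner.liftIm 0 (sleTrace ((8 : ℝ≥0) / 3) ω t)) =
        ψ.boundaryExtension (sleTrace ((8 : ℝ≥0) / 3) ω t) := fun ω t ↦ by
    rw [Loewner.liftIm_of_le (sleTrace_im_nonneg ((8 : ℝ≥0) / 3) ω t)]
  have hrc : ∀ ω : ℝ≥0 → ℝ, Continuous fun t : ℝ≥0 ↦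
      ψ.boundaryExtension (sleTrace ((8 : ℝ≥0) / 3) ω t) := fun ω ↦
    (hΦc.comp (continuous_sleTrace ((8 : ℝ≥0) / 3) ω)).congr fun t ↦ hlift ω t
  have hfc : ∀ ω : ℝ≥0 → ℝ, Continuous fun t : ℝ≥0 ↦
      dist (ψ.boundaryExtension (sleTrace ((8 : ℝ≥0) / 3) ω t)) (E.pt 0) := fun ω ↦
    (hrc ω).dist continuous_const
  have hfm : ∀ t : ℝ≥0, Measurable fun ω : ℝ≥0 → ℝ ↦
      dist (ψ.boundaryExtension (sleTrace ((8 : ℝ≥0) / 3) ω t)) (E.pt 0) := fun t ↦ by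
    have h := (hΦc.measurable.comp (measurable_sleTrace ((8 : ℝ≥0) / 3) t)).dist
      (measurable_const (a := E.pt 0))
    simpa only [Function.comp_def, hlift] using h
  -- almost surely, the deterministic core applies
  have hae : ∀ᵐ ω ∂Process.preWienerMeasure, ∃ ρ₂ : ℝ, 0 < ρ₂ ∧ ∀ u' u : ℝ≥0, u' ≤ u →
      ρ₁ < dist (ψ.boundaryExtension (sleTrace ((8 : ℝ≥0) / 3) ω u')) (E.pt 0) →
      ρ₂ ≤ dist (ψ.boundaryExtension (sleTrace ((8 : ℝ≥0) / 3) ω u)) (E.pt 0) := by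
    filter_upwards [ae_isSimpleTrace_sleTrace_of_le_four_apply hκ0 hκ4,
      tendsto_norm_sleTrace_atTop_of_ne_eight hκ0 eightThirds_ne_eight] with ω hωs hωt
    refine exists_pos_forall_le_dist (hrc ω) ?_ (fun u hu ↦ ?_)
      (E.pt_injective.ne Fin.zero_ne_one) (fun ε hε ↦ ?_) hρ₁
    · rw [sleTrace_zero]
      exact hψ.boundaryExtension_zero
    · have him : 0 < (sleTrace ((8 : ℝ≥0) / 3) ω u).im := hωs.2 u (pos_iff_ne_zero.2 hu)
      refine MarkedDomain.boundaryExtension_ne_pt_zero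
        JordanDomain.exists_continuousOn_extension_holds hψ him.le fun h ↦ ?_
      rw [h, Complex.zero_im] at him
      exact lt_irrefl _ him
    · exact exists_forall_dist_comp_le hωt (sleTrace_im_nonneg ((8 : ℝ≥0) / 3) ω)
        hψ.tendsto_boundaryExtension_cocompact hε
  -- the measurable supersets `B n` along a countable dense set of times
  obtain ⟨S, hSc, hSd⟩ := TopologicalSpace.exists_countable_dense ℝ≥0
  obtain ⟨B, hBmem⟩ : ∃ B : ℕ → Set (ℝ≥0 → ℝ), ∀ n ω, ω ∈ B n ↔ ∃ q' ∈ S, ∃ q ∈ S, q' ≤ q ∧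
      ρ₁ < dist (ψ.boundaryExtension (sleTrace ((8 : ℝ≥0) / 3) ω q')) (E.pt 0) ∧
      dist (ψ.boundaryExtension (sleTrace ((8 : ℝ≥0) / 3) ω q)) (E.pt 0) < 1 / ((n : ℝ) + 1) :=
    ⟨fun n ↦ {ω | ∃ q' ∈ S, ∃ q ∈ S, q' ≤ q ∧
      ρ₁ < dist (ψ.boundaryExtension (sleTrace ((8 : ℝ≥0) / 3) ω q')) (E.pt 0) ∧
      dist (ψ.boundaryExtension (sleTrace ((8 : ℝ≥0) / 3) ω q)) (E.pt 0) < 1 / ((n : ℝ) + 1)},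
      fun _ _ ↦ Iff.rfl⟩
  have hBm : ∀ n, MeasurableSet (B n) := by
    intro n
    have hrep : B n = ⋃ q' ∈ S, ⋃ q ∈ S, {ω : ℝ≥0 → ℝ | q' ≤ q ∧
        ρ₁ < dist (ψ.boundaryExtension (sleTrace ((8 : ℝ≥0) / 3) ω q')) (E.pt 0) ∧
        dist (ψ.boundaryExtension (sleTrace ((8 : ℝ≥0) / 3) ω q)) (E.pt 0) <
          1 / ((n : ℝ) + 1)} := by
      ext ω
      simp only [hBmem, mem_iUnion, mem_setOf_eq, exists_prop]
    rw [hrep]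
    exact MeasurableSet.biUnion hSc fun q' _ ↦ MeasurableSet.biUnion hSc fun q _ ↦
      (MeasurableSet.const _).inter ((measurableSet_lt measurable_const (hfm q')).inter
        (measurableSet_lt (hfm q) measurable_const))
  have hanti : Antitone B := fun n n' hnn' ω hω ↦ by
    obtain ⟨q', hq'S, q, hqS, hq'q, h1, h2⟩ := (hBmem n' ω).1 hω
    exact (hBmem n ω).2 ⟨q', hq'S, q, hqS, hq'q, h1,
      h2.trans_le (Nat.one_div_le_one_div hnn')⟩
  have hnull : Process.preWienerMeasure (⋂ n, B n) = 0 := by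
    rw [measure_eq_zero_iff_ae_notMem]
    filter_upwards [hae] with ω ⟨ρ₂, hρ₂, hω⟩ hmem
    obtain ⟨n, hn⟩ := exists_nat_one_div_lt hρ₂
    obtain ⟨q', -, q, -, hq'q, h1, h2⟩ := (hBmem n ω).1 (mem_iInter.1 hmem n)
    exact absurd ((hω q' q hq'q h1).trans h2.le) (not_le.2 hn)
  have htend := tendsto_measure_iInter_atTop (μ := Process.preWienerMeasure)
    (fun n ↦ (hBm n).nullMeasurableSet) hanti ⟨0, measure_ne_top _ _⟩
  rw [hnull] at htend
  obtain ⟨n, hn⟩ := (htend.eventually_lt_const hβ).exists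
  refine ⟨1 / ((n : ℝ) + 1), by positivity, (measure_mono ?_).trans hn.le⟩
  -- the bad event is contained in `B n` (strict inequalities, continuity in time)
  rintro ω ⟨u', u, hu'u, h1, h2⟩
  rcases hu'u.eq_or_lt with rfl | hlt
  · obtain ⟨q, hqS, hq1, hq2⟩ := hSd.exists_mem_open
      ((isOpen_lt continuous_const (hfc ω)).inter (isOpen_lt (hfc ω) continuous_const))
      ⟨u', h1, h2⟩
    exact (hBmem n ω).2 ⟨q, hqS, q, hqS, le_rfl, hq1, hq2⟩
  · obtain ⟨q, hqS, huq, hq2⟩ := hSd.exists_mem_open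
      ((isOpen_lt continuous_const continuous_id).inter (isOpen_lt (hfc ω) continuous_const))
      ⟨u, hlt, h2⟩
    obtain ⟨q', hq'S, hq'q, hq1⟩ := hSd.exists_mem_open
      ((isOpen_lt continuous_id continuous_const).inter (isOpen_lt continuous_const (hfc ω)))
      ⟨u', huq, h1⟩
    exact (hBmem n ω).2 ⟨q', hq'S, q, hqS, le_of_lt hq'q, hq1, hq2⟩

end Summit.CriticalPhenomena.SAWScalingLimit.Theorems

end
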